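/-
Copyright (c) 2026 the pub-hodgecm-mathlib formalisation cell (harness21).  Prover seat hodgecm-mathlib-K2E5-p08 (g2), Track B «K2-LIT» ∕ h413,
engine E5 «TamagawaUnitary», unit G (ZETA), deal BATCH #8 (c) — ARCH HALF, part 2: AT A REAL PLACE WHERE `h` IS DEFINITE, ADELIC REDUCED NORMS ARE POSITIVE
(explicit `ℍ`-at-infinity computation, complementing ★ `K2E5QuatArchNrdPos`'s density road), and the Eichler identification as an EQUALITY.  2026-09-04.
-/
import Summits.HodgeConjecture.HodgeConjecture.Theorems.K2E5QuatRamifiedRealPlaces         -- ★ (p855746, this seat): `not_isSplitAtInfinite_iff_definite`; brings ★ `conj_mem_quatModel`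
import Summits.HodgeConjecture.HodgeConjecture.Theorems.K2E5QuatAdelicNrdDefs             -- ★ #3i: `quatAdelicNrd`, `quatAdelicUnits`
import Summits.HodgeConjecture.HodgeConjecture.Theorems.K2E5QuatArchNrdPos               -- ★ (p855703, K2E5-p03): `range_inf_principalIdeles_le_map_quatRatLattice` (Eichler ⊇ in the model)
import Literature.NumberTheory.Automorphic.UnitaryGroupArchimedeanPlaces                  -- ★ `embedding_galConj`, `complexConj_smul_infinitePlace`
import Literature.NumberTheory.Automorphic.GaloisActionAdeleRing                          -- ★ `InfiniteAdeleRing.smul_apply`, `galInfiniteCompletionMap_coe`, `Completion.ext_of_coe`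
import Literature.NumberTheory.QuadraticForms.QuadraticNormIndex                          -- ★ `adeleInfiniteComponent`
import HarnessLib

/-!
# K2 ∕ E5 «TamagawaUnitary», unit G (ZETA), deal BATCH #8 (c), ARCH HALF part 2 — `K2E5QuatNrdArchPositivity`:
# **at a real place `w` of `L⁺` where `h` is definite, every adelic reduced norm is positive**: if `Nrd(X) = con(t)` (`X ∈ (D_h ⊗ 𝔸)^×`, `t ∈ L⁺ˣ`)
# then `0 < w(t)` — the explicit archimedean computation `w(t) = |ψ z|² + (w(b)/w(a)) |ψ u|²` (★ `K2E5QuatArchNrdPos` of K2E5-p03 reaches the `hArch`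
# statement by a density road instead; here the `ℍ`-at-infinity structure is made explicit), and **`Nrd(Γ_h) = Nrd((D_h ⊗ 𝔸)^×) ∩ L^×`** as an equality

Cell `hodgecm-mathlib` (Track B «K2-LIT»), engine E5, item h413 = `stmt-HodgeConjecture-24833`; PROOF lane, helper file
(`--supports stmt-HodgeConjecture-24833 --as helper`; theorems only: no `def`, no instance, no notation, no named fact, no `sorry`).
ARCH HALF of the split of deal (c) ED. 2 with K2E5-p03 (g2) (2026-09-03T23:23:06Z); author K2E5-p08 (g2).

THE MATHEMATICS ([VignerasLNM800, Ch. III §1 Exemple p. 61, Ch. III §4 Thm. 4.1]; [PlatonovRapinchuk1994, §2.3]; [Rogawski1990, §3.8]).  `L` CM with complex conjugation `c`,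
`K = L⁺`; `w` a real place of `K`, `w̃` a (complex) place of `L` above it, `F = L_{w̃}` (Mathlib `InfinitePlace.Completion`), `ψ : F →+* ℂ` the extension of `w̃` (Mathlib
`extensionEmbedding`), `σ̃ = c_{w̃}` the conjugation of `F` (★ `galInfiniteCompletionMap`, `c • w̃ = w̃` by ★ `complexConj_smul_infinitePlace`), with `ψ ∘ σ̃ = conj ∘ ψ`
(`extensionEmbedding_galConj`: both continuous, equal on `L` by ★ `embedding_galConj`).
* §1 generic: in the diagonal model `D(σ, diag(a, b))` over a field (`a ≠ 0`) one has `x₁₁ = σ x₀₀`, `x₀₁ = −(b/a) σ x₁₀`, hence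
  **`det x = x₀₀ σ(x₀₀) + (b/a) · x₁₀ σ(x₁₀)`** (`det_eq_of_mem_quatModel_diagonal`); and the inverse-frame identity `ᵗ(σP⁻¹) (ᵗ(σP) H P) P⁻¹ = H`.
* §2 the `w̃`-component `X_{w̃} ∈ M₂(F)` of `X ∈ (D_h ⊗ 𝔸)^×` (★ `adeleInfiniteComponent`, entrywise) lies in `D(σ̃, h ⊗ 1)` (the model equation pushed through the
  ring hom `𝔸_L → F`; `(c ⊗ 1)` becomes `σ̃` by ★ `InfiniteAdeleRing.smul_apply`), its conjugate `P_F⁻¹ X_{w̃} P_F` lies in `D(σ̃, diag(a, b))` (★ `conj_mem_quatModel`),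
  and `det X_{w̃} = t` when `Nrd X = con(t)`.  So `t = z σ̃(z) + (b/a) · u σ̃(u)` in `F` and, under `ψ`, **`w(t) = |ψ z|² + (w(b)/w(a)) |ψ u|² ≥ 0`**, `> 0` as `t ≠ 0`:
  `embedding_pos_of_quatAdelicNrd_eq`.
* §3 the Eichler identification as an EQUALITY of subgroups of `𝕀_L` for anisotropic `h`: **`map_quatRatLattice_eq_range_inf_principalIdeles`**:
  `Nrd(Γ_h) = Nrd((D_h ⊗ 𝔸)^×) ∩ L^×` (`⊇` = ★ `K2E5QuatArchNrdPos.range_inf_principalIdeles_le_map_quatRatLattice` of K2E5-p03 BY NAME; `⊆` = ★ #3j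
  `quatAdelicNrd_mem_principalIdeles`).  (The `hArch` form — positivity at the NON-SPLIT real places via ★ `not_isSplitAtInfinite_iff_definite` — is ★
  `K2E5QuatArchNrdPos.embedding_re_pos_of_mem_range_quatAdelicNrd`, not restated here.)

HONEST LABEL: HC_CM is proved only modulo the 7 printed citations (2 remaining named inputs: hLiu418 = stmt-HodgeConjecture-24832,
h413 = stmt-HodgeConjecture-24833) until rung 0 closes; this helper closes no socket and changes no count.

## References
* [VignerasLNM800] M.-F. Vignéras, *Arithmétique des algèbres de quaternions*, LNM 800 (1980) — Ch. III §1 Exemple p. 61; Ch. III §4 Thm. 4.1.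
* [PlatonovRapinchuk1994] V. Platonov, A. Rapinchuk, *Algebraic Groups and Number Theory* (1994) — §2.3, §8.2.
* [Rogawski1990] J. D. Rogawski, *Automorphic Representations of Unitary Groups in Three Variables* (1990) — §3.8 p. 30.
-/

set_option autoImplicit false
set_option linter.dupNamespace false

noncomputable section

namespace Summit.HodgeConjecture.HodgeConjecture.Cruxes.H413.K2E5QuatNrdArchPositivity

open NumberField IsDedekindDomain
open Literature.NumberTheory.Automorphic Literature.NumberTheory.Automorphic.UnitaryGroup
open Literature.NumberTheory.GaloisRepresentations (principalIdeles)
open Summit.HodgeConjecture.HodgeConjecture.Cruxes.H413.K2E5QuatAdelicMatrixModel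
open Summit.HodgeConjecture.HodgeConjecture.Cruxes.H413.K2E5QuatAdelicNrd
open Summit.HodgeConjecture.HodgeConjecture.Cruxes.H413.K2E5QuatLocalNrdSurjective
open Summit.HodgeConjecture.HodgeConjecture.Cruxes.H413.K2E5QuatZeta
open Summit.HodgeConjecture.HodgeConjecture.Cruxes.H413.K2E5QuatAdelicLattice
open scoped Matrix MatrixGroups ComplexConjugate

/-! ## §1 Generic: the reduced norm in a diagonal model over a field; the inverse-frame identity -/

section Generic

/-- **In `D(σ, diag(a, b))` the determinant is `x₀₀ σ(x₀₀) + (b/a) x₁₀ σ(x₁₀)`** (`a ≠ 0`): the model equation forces `x₁₁ = σ x₀₀` and `x₀₁ = −(b/a) σ x₁₀` — the norm form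
`N(α) + e N(γ)` of the `{E, e}`-presentation read backwards. [cite: VignerasLNM800, Ch. I §1 p. 3] -/
theorem det_eq_of_mem_quatModel_diagonal {F : Type*} [Field F] (σ : F →+* F) {a b : F} (ha : a ≠ 0) {x : Matrix (Fin 2) (Fin 2) F}
    (hx : x ∈ quatModel σ (Matrix.diagonal ![a, b])) :
    x.det = x 0 0 * σ (x 0 0) + b / a * (x 1 0 * σ (x 1 0)) := by
  rw [mem_quatModel_iff, Matrix.adjugate_fin_two] at hx
  have h00 := congrFun (congrFun hx 0) 0
  have h01 := congrFun (congrFun hx 0) 1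
  simp [Matrix.mul_apply, Matrix.diagonal] at h00 h01
  -- `h00 : σ (x 0 0) * a = a * x 1 1`, `h01 : σ (x 1 0) * b = -(a * x 0 1)`
  have h11 : x 1 1 = σ (x 0 0) := by
    have := h00
    rw [mul_comm] at this
    exact (mul_left_cancel₀ ha this).symm
  have h01' : x 0 1 = -(b / a * σ (x 1 0)) := by
    field_simp
    linear_combination h01
  rw [Matrix.det_fin_two, h11, h01']
  ring

/-- The inverse-frame identity `ᵗ(σP⁻¹) · (ᵗ(σP) H P) · P⁻¹ = H`. [folklore] -/
theorem inv_frame_eq {R : Type*} [CommRing R] (σ : R →+* R) (P : GL (Fin 2) R) (H : Matrix (Fin 2) (Fin 2) R) :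
    ((((P⁻¹ : GL (Fin 2) R) : Matrix (Fin 2) (Fin 2) R)).map σ)ᵀ *
        ((((P : Matrix (Fin 2) (Fin 2) R)).map σ)ᵀ * H * (P : Matrix (Fin 2) (Fin 2) R)) * ((P⁻¹ : GL (Fin 2) R) : Matrix (Fin 2) (Fin 2) R) = H := by
  have hpq : (P : Matrix (Fin 2) (Fin 2) R) * ((P⁻¹ : GL (Fin 2) R) : Matrix (Fin 2) (Fin 2) R) = 1 := by
    rw [← Units.val_mul, mul_inv_cancel, Units.val_one]
  have hσ : ((((P⁻¹ : GL (Fin 2) R) : Matrix (Fin 2) (Fin 2) R)).map σ)ᵀ * (((P : Matrix (Fin 2) (Fin 2) R)).map σ)ᵀ = 1 := by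
    rw [← Matrix.transpose_mul, ← Matrix.map_mul, hpq, Matrix.map_one σ (map_zero σ) (map_one σ), Matrix.transpose_one]
  calc _ = (((((P⁻¹ : GL (Fin 2) R) : Matrix (Fin 2) (Fin 2) R)).map σ)ᵀ * (((P : Matrix (Fin 2) (Fin 2) R)).map σ)ᵀ) * H *
        ((P : Matrix (Fin 2) (Fin 2) R) * ((P⁻¹ : GL (Fin 2) R) : Matrix (Fin 2) (Fin 2) R)) := by simp only [Matrix.mul_assoc]
    _ = H := by rw [hσ, hpq, Matrix.one_mul, Matrix.mul_one]

end Generic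

/-! ## §2 The component of `(D_h ⊗ 𝔸)^×` at a complex place and the positivity of reduced norms at definite real places -/

section Arch

variable (L : Type) [Field L] [NumberField L] [IsCMField L] (Ha : Matrix (Fin 2) (Fin 2) L)

/-- **`ψ ∘ c_{w̃} = conj ∘ ψ`** for the extension `ψ : L_{w̃} →+* ℂ` of a (complex) place `w̃` of the CM field `L` and the conjugation `c_{w̃}` of `L_{w̃}` (★
`galInfiniteCompletionMap` at `c • w̃ = w̃`): two continuous maps agreeing on `L` (★ `embedding_galConj`). [cite: PlatonovRapinchuk1994, §2.3] -/
theorem extensionEmbedding_galConj (w : InfinitePlace L) (hw : IsCMField.complexConj L • w = w) (z : w.Completion) :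
    InfinitePlace.Completion.extensionEmbedding w (galInfiniteCompletionMap (IsCMField.complexConj L) hw z) =
      conj (InfinitePlace.Completion.extensionEmbedding w z) := by
  have hc : w.IsComplex := IsTotallyComplex.isComplex w
  have h := InfinitePlace.Completion.ext_of_coe w
    (f := fun z => InfinitePlace.Completion.extensionEmbedding w (galInfiniteCompletionMap (IsCMField.complexConj L) hw z))
    (f' := fun z => conj (InfinitePlace.Completion.extensionEmbedding w z))
    ((InfinitePlace.Completion.isometry_extensionEmbedding w).continuous.comp (continuous_galInfiniteCompletionMap (↥(maximalRealSubfield L)) _ hw))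
    (Complex.continuous_conj.comp (InfinitePlace.Completion.isometry_extensionEmbedding w).continuous) fun x => by
      show InfinitePlace.Completion.extensionEmbedding w (galInfiniteCompletionMap (IsCMField.complexConj L) hw (x : w.Completion)) =
        conj (InfinitePlace.Completion.extensionEmbedding w (x : w.Completion))
      rw [galInfiniteCompletionMap_coe (↥(maximalRealSubfield L)) (IsCMField.complexConj L) hw x,
        show InfinitePlace.Completion.extensionEmbedding w ((IsCMField.complexConj L x : L) : w.Completion) = w.embedding (IsCMField.complexConj L x) by simp,
        show InfinitePlace.Completion.extensionEmbedding w (x : w.Completion) = w.embedding x by simp]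
      exact UnitaryGroup.embedding_galConj (↥(maximalRealSubfield L)) L (IsCMField.complexConj L) ⟨w, hc⟩ hw (IsCMField.complexConj_ne_one L) _
  exact congrFun h z

/-- **POSITIVITY OF REDUCED NORMS AT A DEFINITE REAL PLACE.**  Let `ᵗ(cP) h P = diag(a, b)` be a diagonal frame (`a, b ∈ L⁺ˣ`), `w` a real place of `L⁺` with `w(a) w(b) > 0`
(`h` definite at `w`), and `X ∈ (D_h ⊗ 𝔸)^×` with `Nrd X = con(t)`, `t ∈ L⁺ˣ`.  Then `0 < w(t)`: at the complex place `w̃ ∣ w`, `t = z σ̃(z) + (b/a) u σ̃(u)` in `L_{w̃}` for the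
entries `z, u` of `P⁻¹ X_{w̃} P`, i.e. `w(t) = |ψ z|² + (w(b)/w(a)) |ψ u|²`. [cite: VignerasLNM800, Ch. III §1 Exemple p. 61] [cite: PlatonovRapinchuk1994, §2.3] -/
theorem embedding_pos_of_quatAdelicNrd_eq
    (P : GL (Fin 2) L) (a b : ↥(maximalRealSubfield L)) (ha : a ≠ 0)
    (hP : ((P : Matrix (Fin 2) (Fin 2) L).map (cmConjRingHom L))ᵀ * Ha * (P : Matrix (Fin 2) (Fin 2) L) = Matrix.diagonal ![(a : L), (b : L)])
    (w : InfinitePlace ↥(maximalRealSubfield L)) (hw : w.IsReal)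
    (hdef : 0 < InfinitePlace.embedding_of_isReal hw a * InfinitePlace.embedding_of_isReal hw b)
    (t : ↥(maximalRealSubfield L)) (ht : t ≠ 0) (X : ↥(quatAdelicUnits L Ha))
    (hX : ((quatAdelicNrd L Ha X : (AdeleRing (𝓞 L) L)ˣ) : AdeleRing (𝓞 L) L) = algebraMap L (AdeleRing (𝓞 L) L) (algebraMap (↥(maximalRealSubfield L)) L t)) :
    0 < InfinitePlace.embedding_of_isReal hw t := by
  classical
  -- a complex place `w̃` of `L` above `w`, the completion `F = L_{w̃}`, its conjugation `σ̃`, and `ψ : F → ℂ`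
  obtain ⟨wt, hwt⟩ := InfinitePlace.comap_surjective (k := ↥(maximalRealSubfield L)) (K := L) w
  change wt.comap (algebraMap (↥(maximalRealSubfield L)) L) = w at hwt
  have hcw : IsCMField.complexConj L • wt = wt := complexConj_smul_infinitePlace L wt
  set σt := galInfiniteCompletionMap (IsCMField.complexConj L) hcw with hσt
  set π : AdeleRing (𝓞 L) L →+* wt.Completion := Literature.NumberTheory.QuadraticForms.adeleInfiniteComponent L wt with hπ
  set ψ := InfinitePlace.Completion.extensionEmbedding wt with hψ
  set ι : L →+* wt.Completion := algebraMap L wt.Completion with hι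
  have hπσ : ∀ z : AdeleRing (𝓞 L) L, π (adeleConj L z) = σt (π z) := fun z => by
    rw [hπ, Literature.NumberTheory.QuadraticForms.adeleInfiniteComponent_apply, Literature.NumberTheory.QuadraticForms.adeleInfiniteComponent_apply,
      adeleConj_apply, Literature.NumberTheory.Automorphic.AdeleRing.smul_fst, InfiniteAdeleRing.smul_apply]
    exact galInfiniteCompletionMap_apply_congr_place (↥(maximalRealSubfield L)) (inv_smul_eq_iff.2 hcw.symm) _ hcw (fun u => z.1 u)
  have hσι : ∀ x : L, σt (ι x) = ι (cmConjRingHom L x) := fun x => galInfiniteCompletionMap_coe (↥(maximalRealSubfield L)) (IsCMField.complexConj L) hcw x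
  have hπι : ∀ x : L, π (algebraMap L (AdeleRing (𝓞 L) L) x) = ι x := fun x => rfl
  have hψσ : ∀ z, ψ (σt z) = conj (ψ z) := extensionEmbedding_galConj L wt hcw
  have hψι : ∀ y : L, ψ (ι y) = wt.embedding y := fun y => by rw [hψ, hι]; simp
  have hψK : ∀ k : ↥(maximalRealSubfield L), ψ (ι (algebraMap (↥(maximalRealSubfield L)) L k)) = (InfinitePlace.embedding_of_isReal hw k : ℂ) := by
    intro k
    rw [InfinitePlace.embedding_of_isReal_apply, hψι]
    have hreal : (wt.comap (algebraMap (↥(maximalRealSubfield L)) L)).IsReal := by rw [hwt]; exact hw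
    have h := InfinitePlace.comap_embedding_of_isReal (algebraMap (↥(maximalRealSubfield L)) L) hreal
    rw [hwt] at h
    rw [h]
    rfl
  -- the `w̃`-component of `X` lies in the model `D(σ̃, h ⊗ 1)` over `F`
  set Xm : Matrix (Fin 2) (Fin 2) (AdeleRing (𝓞 L) L) := ((X : GL (Fin 2) (AdeleRing (𝓞 L) L)) : Matrix (Fin 2) (Fin 2) (AdeleRing (𝓞 L) L)) with hXm
  have hXD : Xm ∈ quatAdelic L Ha := (mem_quatAdelicUnits_iff L Ha _).1 X.2
  set Y : Matrix (Fin 2) (Fin 2) wt.Completion := Xm.map π with hY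
  set HF : Matrix (Fin 2) (Fin 2) wt.Completion := Ha.map ι with hHF
  have hYτ : (Xm.map (adeleConj L)).map π = Y.map σt := by
    ext i j
    simp only [Matrix.map_apply, hY, hπσ]
  have hHπ : (Ha.map (algebraMap L (AdeleRing (𝓞 L) L))).map π = HF := by
    ext i j
    simp only [Matrix.map_apply, hHF, hπι]
  have hYD : Y ∈ quatModel σt HF := by
    rw [mem_quatModel_iff]
    have h := congrArg (fun M : Matrix (Fin 2) (Fin 2) (AdeleRing (𝓞 L) L) => M.map π) ((mem_quatAdelic_iff L Ha Xm).1 hXD)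
    rw [Matrix.map_mul, Matrix.map_mul, Matrix.transpose_map, hYτ, hHπ] at h
    rw [h, ← RingHom.mapMatrix_apply, RingHom.map_adjugate, RingHom.mapMatrix_apply]
  -- the frame over `F`
  obtain ⟨PF, hPF⟩ : ∃ PF : GL (Fin 2) wt.Completion, (PF : Matrix (Fin 2) (Fin 2) wt.Completion) = (P : Matrix (Fin 2) (Fin 2) L).map ι :=
    ⟨Matrix.GeneralLinearGroup.map ι P, rfl⟩
  have hframe : (((PF : Matrix (Fin 2) (Fin 2) wt.Completion)).map σt)ᵀ * HF * (PF : Matrix (Fin 2) (Fin 2) wt.Completion) =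
      Matrix.diagonal ![ι (a : L), ι (b : L)] := by
    have hmaps : ((P : Matrix (Fin 2) (Fin 2) L).map ι).map σt = ((P : Matrix (Fin 2) (Fin 2) L).map (cmConjRingHom L)).map ι := by
      rw [Matrix.map_map, Matrix.map_map]
      exact congrArg _ (funext fun x => hσι x)
    rw [hPF, hmaps, hHF, ← Matrix.transpose_map, ← Matrix.map_mul, ← Matrix.map_mul, hP, Matrix.diagonal_map (map_zero ι)]
    congr 1
    funext i
    fin_cases i <;> rfl
  set x' : Matrix (Fin 2) (Fin 2) wt.Completion :=
    ((PF⁻¹ : GL (Fin 2) wt.Completion) : Matrix (Fin 2) (Fin 2) wt.Completion) * Y * (PF : Matrix (Fin 2) (Fin 2) wt.Completion) with hx'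
  have hx'D : x' ∈ quatModel σt (Matrix.diagonal ![ι (a : L), ι (b : L)]) := by
    have h := conj_mem_quatModel σt PF⁻¹ (Matrix.diagonal ![ι (a : L), ι (b : L)]) (x := Y) (by rw [← hframe, inv_frame_eq]; exact hYD)
    rw [inv_inv] at h
    exact h
  -- its determinant is `t`
  have hdetY : Y.det = ι (algebraMap (↥(maximalRealSubfield L)) L t) := by
    rw [hY, ← RingHom.mapMatrix_apply, ← RingHom.map_det, hXm, ← coe_quatAdelicNrd, hX, hπι]
  have hdetx' : x'.det = ι (algebraMap (↥(maximalRealSubfield L)) L t) := by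
    have hqp : ((PF⁻¹ : GL (Fin 2) wt.Completion) : Matrix (Fin 2) (Fin 2) wt.Completion).det * (PF : Matrix (Fin 2) (Fin 2) wt.Completion).det = 1 := by
      rw [← Matrix.det_mul, ← Units.val_mul, inv_mul_cancel, Units.val_one, Matrix.det_one]
    rw [hx', Matrix.det_mul, Matrix.det_mul, hdetY, mul_assoc, mul_comm (ι _), ← mul_assoc, hqp, one_mul]
  -- `t = z σ̃ z + (b/a) u σ̃ u` in `F`
  have haι : ι (a : L) ≠ 0 := (map_ne_zero ι).2 (fun h => ha (Subtype.ext h))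
  have hkey := det_eq_of_mem_quatModel_diagonal σt haι hx'D
  rw [hdetx'] at hkey
  -- apply `ψ`
  have hψkey := congrArg ψ hkey
  rw [map_add, map_mul, map_mul, map_mul, map_div₀, hψσ, hψσ, Complex.mul_conj, Complex.mul_conj, hψK t] at hψkey
  have ha' : ψ (ι (a : L)) = (InfinitePlace.embedding_of_isReal hw a : ℂ) := hψK a
  have hb' : ψ (ι (b : L)) = (InfinitePlace.embedding_of_isReal hw b : ℂ) := hψK b
  rw [ha', hb'] at hψkey
  -- read in `ℝ`
  have hre : InfinitePlace.embedding_of_isReal hw t =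
      Complex.normSq (ψ (x' 0 0)) + InfinitePlace.embedding_of_isReal hw b / InfinitePlace.embedding_of_isReal hw a * Complex.normSq (ψ (x' 1 0)) := by
    exact_mod_cast hψkey
  have hea : InfinitePlace.embedding_of_isReal hw a ≠ 0 := (map_ne_zero _).2 ha
  have hquot : 0 < InfinitePlace.embedding_of_isReal hw b / InfinitePlace.embedding_of_isReal hw a := by
    have := div_pos hdef (mul_self_pos.2 hea)
    rwa [mul_comm, mul_div_mul_right _ _ hea] at this
  have hnonneg : 0 ≤ InfinitePlace.embedding_of_isReal hw t := by
    rw [hre]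
    exact add_nonneg (Complex.normSq_nonneg _) (mul_nonneg hquot.le (Complex.normSq_nonneg _))
  have hne : InfinitePlace.embedding_of_isReal hw t ≠ 0 := (map_ne_zero _).2 ht
  exact lt_of_le_of_ne hnonneg hne.symm

/-! ## §3 The Eichler identification as an equality -/

/-- **EICHLER IDENTIFICATION (anisotropic `h`): `Nrd(Γ_h) = Nrd((D_h ⊗ 𝔸)^×) ∩ L^×`** as subgroups of `𝕀_L` — `⊇` is ★ `K2E5QuatArchNrdPos.range_inf_principalIdeles_le_map_quatRatLattice`
(K2E5-p03: ★ D4 Eichler applied in the model + the arch half), `⊆` is ★ #3j `quatAdelicNrd_mem_principalIdeles`. [cite: VignerasLNM800, Ch. III §4 Thm. 4.1; Ch. III §2 (proof of Thm. 2.3)] -/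
theorem map_quatRatLattice_eq_range_inf_principalIdeles (hHa : (Ha.map (cmConjRingHom L)).transpose = Ha)
    (han : ∀ v : Fin 2 → L, Literature.AlgebraicGeometry.ShimuraVarieties.hermForm (cmConjRingHom L) Ha v v = 0 → v = 0) (hdet : Ha.det ≠ 0) :
    (quatRatLattice L Ha).map (quatAdelicNrd L Ha) = (quatAdelicNrd L Ha).range ⊓ principalIdeles L := by
  refine le_antisymm ?_ (K2E5QuatArchNrdPos.range_inf_principalIdeles_le_map_quatRatLattice L Ha hHa han hdet)
  rintro _ ⟨x, hx, rfl⟩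
  exact Subgroup.mem_inf.2 ⟨⟨x, rfl⟩, quatAdelicNrd_mem_principalIdeles L Ha hx⟩

end Arch

end Summit.HodgeConjecture.HodgeConjecture.Cruxes.H413.K2E5QuatNrdArchPositivity

end
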